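import Literature.Combinatorics.Optimization.ShellLawBulkSmoothness
import HarnessLib

/-!
# Weighted sections of the number of `HH` edges inside a cut: the component decomposition with the
# weight riding along, and the pointwise good/far `x`-smoothness bound

Continuation of `ShellLawGeneratingPolynomial.lean` (§2–§3: the generating polynomial of the shell law of the
block statistic `X = |U ∩ H|` is the nonnegative combination `Σ_{Y,α} C(a_Y,α)·X^{|Y∩H|+2α}·H_{b_Y,d_Y,s−α}` of
shifted hypergeometric generating polynomials over the components `(Y, α)` = (half-set, number of `HH` edges
among the full ones)), `ShellLawPointwiseMixture.lean` (the good/far mixture inequality at one point) and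
`ShellLawBulkSmoothness.lean` (§5: the pointwise relative `x`-smoothness of a level-`1` shell law in the
moderate-deviation window). Fix a fixed-point-free involution `π` (a perfect matching), a `π`-stable ground set
`S`, a block `H`, and a WEIGHT `w : ℕ → ℝ` on the number `n_A(U) = #{v ∈ reps(vAA_π(S,H)) : v, πv ∈ U}` of `HH`
edges of `S` inside the cut `U`. IN THE COMPONENT `(Y, α)` THE NUMBER `n_A` IS THE CONSTANT `α`
(`hhCount_union_eq`), so the weight rides along the whole decomposition:

* §1 `sum_shellIn_eq_sum_halfSets` — the half-set decomposition for an ARBITRARY function of the cut: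
  `Σ_{U ∈ Shell_S(t,c)} F(U) = Σ_{Y ∈ halfSets(S,c)} Σ_{W ∈ Shell_{S∖(Y∪πY)}(t−c,0)} F(W ∪ Y)`;
* §2 bookkeeping: `n_A(W ∪ Y) = #reps(W ∩ vAA(S∖(Y∪πY)))`, `|(W∪Y) ∩ H| = |W∩H| + |Y∩H|`;
* §3 `weightedShellGen_zero_eq_sum_hyperGen` (level `0`), §4 **`weightedShellGen_eq_sum_halfSets_hyperGen`**:
  `Σ_{U ∈ Shell_S(c+2s,c)} w(n_A(U))·X^{|U∩H|} = Σ_{Y,α} w(α)·C(a_Y,α)·X^{|Y∩H|+2α}·H_{b_Y,d_Y,s−α}` — the SAME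
  components, weights `w(α)C(a_Y,α)`;
* §5 the dictionary: the WEIGHTED SECTION `P^w_S(t,c;x) = (Σ_{U ∈ Shell_S(t,c), |U∩H| = x} w(n_A(U)))/|Shell_S(t,c)|`
  is `|Shell|⁻¹` times the coefficient sequence of the weighted generating polynomial, and its iterated second
  `x`-differences are the coefficients of `(1−X)^{2m}·G^w` (`nab2_iter_weightedSection_natCast_eq`);
* §6 **`abs_nab2_iter_weightedSection_le_of_good_far`** — the good/far inequality at one point for a weighted
  section with `0 ≤ w(α) ≤ W̄` (`α ≤ s`): `|(∇²)^m P^w(c)(i)| ≤ E·P^w(c; y₀) + A·W̄`, with EXACTLY the per-component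
  hypotheses of `abs_nab2_iter_shellLaw_le_of_good_far` (the law is `w ≡ 1`);
* §7 **`abs_nab2_iter_weightedSection_one_le`** — the level-`1` moderate-deviation bound with the SAME constants
  as `abs_nab2_iter_shellLaw_one_le`: `|(∇²)^k P^w(1)(y₀+u)| ≤ E_k(N)·P^w(1; y₀) + W̄·4^k·e^{−(L−2k)²/(4N)}`
  (the good and far component bounds of `ShellLawBulkSmoothness` §3–§4 verbatim).

All PROVED, 0 sorry, no definitions, no named facts. Cell pnp-psdrank (prover g27, MEMO-30 (B2)): with
`w(α) = (α − m)²` this is the `x`-smoothness of the centred second moment `E[1_{X=x}(n_A − m)²]` needed for the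
`k = 1` term `main_one_eq` of `ShellLawCentredMomentLevelStep`; nothing here is about psd rank or P vs NP.

## References
* [RollinRoss2010] A. Röllin, N. Ross, *Local limit theorems via Landau–Kolmogorov inequalities*, Bernoulli 21
  (2015) 851–880, §3 Lemma 3.3 (conditioning / mixtures), Lemma 3.1; §4.1 Thm 4.2.
* [Rothvoss2017] T. Rothvoß, *The matching polytope has exponential extension complexity*, J. ACM 64 (2017), §2
  (PDF pp. 5–6): cuts, the partition of a cut by a perfect matching, the level classes.
* [VatutinMikhailov1983] V. A. Vatutin, V. G. Mikhailov, Theory Probab. Appl. 27 (1983) 734–743, §2 (the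
  hypergeometric generating polynomial).
* [Durrett2019] R. Durrett, *Probability: Theory and Examples*, 5th ed. (2019), §2.7 (Chernoff).
-/

noncomputable section

open Finset Polynomial

namespace Literature.Combinatorics.Optimization

namespace ShellStep

open Literature.Combinatorics.StablePolynomials (hyperGen coeff_hyperGen coeff_hyperGen_nonneg eval_one_hyperGen)

variable {n : ℕ} {π : Fin n → Fin n}

/-! ### §1 The half-set decomposition of a shell sum of an arbitrary function of the cut -/

section HalfSets

variable (hπ : ∀ v, π (π v) = v) (hπ' : ∀ v, π v ≠ v)
include hπ hπ'

omit hπ' in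
/-- **The half-set decomposition of a shell sum.** Grouping the members `U` of `Shell_S(t,c)` by their half-set
`Y = half(U)`: `U ∖ Y` runs over the level-`0` shell of the stripped ground set `S ∖ (Y ∪ πY)` with cut size
`t − c`, and `U = (U ∖ Y) ∪ Y`; hence for every function `F` of the cut
`Σ_{U ∈ Shell_S(t,c)} F(U) = Σ_{Y ∈ halfSets(S,c)} Σ_{W ∈ Shell_{S∖(Y∪πY)}(t−c,0)} F(W ∪ Y)`
(the bijection of `shellCount_eq_sum_halfSets`, for sums). [cite: Rothvoss2017, §2 (PDF p. 6)] -/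
theorem sum_shellIn_eq_sum_halfSets {M : Type*} [AddCommMonoid M] {S : Finset (Fin n)} (F : Finset (Fin n) → M)
    {t c : ℕ} (hct : c ≤ t) :
    ∑ U ∈ shellIn π S t c, F U =
      ∑ Y ∈ halfSets π S c, ∑ W ∈ shellIn π (strip π S Y) (t - c) 0, F (W ∪ Y) := by
  classical
  rw [← sum_fiberwise_of_maps_to (s := shellIn π S t c) (t := halfSets π S c) (g := half π)
    (fun U hU => half_mem_halfSets hU)]
  refine sum_congr rfl fun Y hY => ?_
  obtain ⟨hYS, hYc, hYπ⟩ := mem_halfSets.1 hY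
  refine sum_nbij' (fun U => U \ Y) (fun W => W ∪ Y) ?_ ?_ ?_ ?_ ?_
  · intro U hU
    simp only [mem_filter, mem_shellIn] at hU ⊢
    obtain ⟨⟨hUS, hUt, hUc⟩, hUY⟩ := hU
    subst hUY
    have hfull : ∀ w ∈ U \ half π U, π w ∈ U \ half π U := by
      intro w hw
      obtain ⟨hwU, hwh⟩ := mem_sdiff.1 hw
      have hπwU : π w ∈ U := by
        by_contra h
        exact hwh (mem_half.2 ⟨hwU, h⟩)
      refine mem_sdiff.2 ⟨hπwU, fun h => ?_⟩
      have := (mem_half.1 h).2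
      rw [hπ] at this
      exact this hwU
    refine ⟨?_, ?_, ?_⟩
    · intro w hw
      obtain ⟨hwU, hwh⟩ := mem_sdiff.1 hw
      rw [mem_strip hπ]
      refine ⟨hUS hwU, hwh, fun h => ?_⟩
      have := (mem_half.1 h).2
      rw [hπ] at this
      exact this hwU
    · rw [card_sdiff_of_subset (half_subset (π := π) U), hUt, hUc]
    · rw [card_eq_zero, eq_empty_iff_forall_notMem]
      intro w hw
      exact (mem_half.1 hw).2 (hfull w (mem_half.1 hw).1)
  · intro W hW
    simp only [mem_filter, mem_shellIn] at hW ⊢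
    obtain ⟨hWS, hWt, hWc⟩ := hW
    have hWY : Disjoint W Y := by
      rw [disjoint_left]
      intro w hw hwY
      exact ((mem_strip hπ).1 (hWS hw)).2.1 hwY
    have hWstable : ∀ w ∈ W, π w ∈ W := by
      intro w hw
      by_contra h
      have : w ∈ half π W := mem_half.2 ⟨hw, h⟩
      rw [card_eq_zero] at hWc
      rw [hWc] at this
      exact notMem_empty _ this
    have hhalf : half π (W ∪ Y) = Y := by
      ext v
      simp only [mem_half, mem_union, not_or]
      constructor
      · rintro ⟨hv | hv, hπW, hπY⟩
        · exact absurd (hWstable v hv) hπW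
        · exact hv
      · intro hv
        refine ⟨Or.inr hv, fun h => ?_, hYπ v hv⟩
        have := ((mem_strip hπ).1 (hWS h)).2.2
        rw [hπ] at this
        exact this hv
    refine ⟨⟨?_, ?_, ?_⟩, hhalf⟩
    · exact union_subset (fun w hw => ((mem_strip hπ).1 (hWS hw)).1) hYS
    · rw [card_union_of_disjoint hWY, hWt, hYc]; omega
    · rw [hhalf, hYc]
  · intro U hU
    simp only [mem_filter] at hU
    rw [← hU.2]
    exact sdiff_union_of_subset (half_subset (π := π) U)
  · intro W hW
    simp only [mem_shellIn] at hW
    have hWY : Disjoint W Y := by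
      rw [disjoint_left]
      intro w hw hwY
      exact ((mem_strip hπ).1 (hW.1 hw)).2.1 hwY
    exact union_sdiff_cancel_right hWY
  · intro U hU
    simp only [mem_filter] at hU
    rw [← hU.2, sdiff_union_of_subset (half_subset (π := π) U)]

/-! ### §2 Bookkeeping: in the component `(Y, α)` the number of `HH` edges inside the cut is `α` -/

omit hπ' in
/-- **`n_A` on the fibre.** For an admissible half-set `Y` of `S` and a fully matched `W` in the stripped ground set,
the `HH` edges of `S` inside `W ∪ Y` are the `HH` edges of `S ∖ (Y ∪ πY)` inside `W`:
`{v ∈ reps(vAA_π(S,H)) : v, πv ∈ W ∪ Y} = reps(W ∩ vAA_π(S∖(Y∪πY),H))`. [cite: Rothvoss2017, §2 (PDF p. 6)] -/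
theorem hhCount_union_eq {S Y W : Finset (Fin n)} (H : Finset (Fin n)) {c t' : ℕ} (hY : Y ∈ halfSets π S c)
    (hW : W ∈ shellIn π (strip π S Y) t' 0) :
    ((reps π (vAA π S H)).filter fun v => v ∈ W ∪ Y ∧ π v ∈ W ∪ Y) = reps π (W ∩ vAA π (strip π S Y) H) := by
  obtain ⟨-, -, hYπ⟩ := mem_halfSets.1 hY
  obtain ⟨hWS, -, hWst⟩ := mem_shellIn_zero.1 hW
  ext v
  simp only [mem_filter, mem_reps, mem_vAA, mem_inter, mem_union]
  constructor
  · rintro ⟨⟨⟨hvS, hvH, hπvH⟩, hlt⟩, hv, hπv⟩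
    have hvW : v ∈ W := by
      rcases hv with hv | hv
      · exact hv
      · rcases hπv with hπv | hπv
        · have := hWst _ hπv
          rwa [hπ] at this
        · exact absurd hπv (hYπ v hv)
    exact ⟨⟨hvW, hWS hvW, hvH, hπvH⟩, hlt⟩
  · rintro ⟨⟨hvW, hvs, hvH, hπvH⟩, hlt⟩
    exact ⟨⟨⟨((mem_strip hπ).1 hvs).1, hvH, hπvH⟩, hlt⟩, Or.inl hvW, Or.inl (hWst v hvW)⟩

omit hπ' in
/-- The block statistic on the fibre: `|(W ∪ Y) ∩ H| = |W ∩ H| + |Y ∩ H|` (`W` avoids `Y`).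
[cite: Rothvoss2017, §2 (PDF p. 6)] -/
theorem card_union_inter_eq {S Y W : Finset (Fin n)} (H : Finset (Fin n)) {t' c' : ℕ}
    (hW : W ∈ shellIn π (strip π S Y) t' c') :
    ((W ∪ Y) ∩ H).card = (W ∩ H).card + (Y ∩ H).card := by
  have hWS := (mem_shellIn.1 hW).1
  have hWY : Disjoint W Y := by
    rw [disjoint_left]
    intro w hw hwY
    exact ((mem_strip hπ).1 (hWS hw)).2.1 hwY
  rw [union_inter_distrib_right, card_union_of_disjoint
    (disjoint_of_subset_left inter_subset_left (disjoint_of_subset_right inter_subset_left hWY))]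

/-! ### §3 Level `0`: the weighted generating polynomial is `Σ_α w(α)C(a,α) X^{2α} H_{b,d,s−α}` -/

/-- **Level `0`, weighted.** For a `π`-stable ground set `S` with `a` edges of type `HH`, `b` mixed and `d` of type
`H̄H̄`, and a weight `w` on the number of `HH` edges inside the cut:
`Σ_{W ∈ Shell_S(2s,0)} w(#HH(W))·X^{|W∩H|} = Σ_{α ≤ s} w(α)C(a,α)·X^{2α}·H_{b,d,s−α}` (inside the `(α,β)` type
class the weight is constant). [cite: Rothvoss2017, §2 (PDF p. 6)] [cite: VatutinMikhailov1983, §2] -/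
theorem weightedShellGen_zero_eq_sum_hyperGen {S : Finset (Fin n)} (hS : ∀ v ∈ S, π v ∈ S)
    (H : Finset (Fin n)) (w : ℕ → ℝ) (s : ℕ) :
    ∑ W ∈ shellIn π S (2 * s) 0, C (w (reps π (W ∩ vAA π S H)).card) * (X : ℝ[X]) ^ (W ∩ H).card =
      ∑ α ∈ range (s + 1), C (w α * (((reps π (vAA π S H)).card.choose α : ℕ) : ℝ)) * X ^ (2 * α) *
        hyperGen (reps π (vBH π S H ∪ vBN π S H)).card (reps π (vDD π S H)).card (s - α) := by
  rw [← sum_fiberwise_of_maps_to (s := shellIn π S (2 * s) 0) (t := range (s + 1))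
    (g := fun W => (reps π (W ∩ vAA π S H)).card) (fun W hW => by
      have h := level_zero_bookkeeping hπ hπ' hS H hW
      rw [mem_range]
      omega)]
  refine sum_congr rfl fun α hα => ?_
  have hαs : α ≤ s := Nat.lt_succ_iff.1 (mem_range.1 hα)
  rw [← sum_fiberwise_of_maps_to
    (s := (shellIn π S (2 * s) 0).filter fun W => (reps π (W ∩ vAA π S H)).card = α)
    (t := range (s - α + 1)) (g := fun W => (reps π (W ∩ (vBH π S H ∪ vBN π S H))).card)
    (fun W hW => by
      rw [mem_filter] at hW
      have h := level_zero_bookkeeping hπ hπ' hS H hW.1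
      rw [mem_range]
      omega)]
  rw [hyperGen, mul_sum]
  refine sum_congr rfl fun β hβ => ?_
  have hβs : β ≤ s - α := Nat.lt_succ_iff.1 (mem_range.1 hβ)
  rw [filter_filter]
  have hfib : ∀ W ∈ (shellIn π S (2 * s) 0).filter (fun W => (reps π (W ∩ vAA π S H)).card = α ∧
      (reps π (W ∩ (vBH π S H ∪ vBN π S H))).card = β),
      C (w (reps π (W ∩ vAA π S H)).card) * (X : ℝ[X]) ^ (W ∩ H).card = C (w α) * X ^ (2 * α + β) := by
    intro W hW
    rw [mem_filter] at hW
    obtain ⟨hW, hWα, hWβ⟩ := hW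
    rw [(level_zero_bookkeeping hπ hπ' hS H hW).2.2.1, hWα, hWβ]
  rw [sum_congr rfl hfib, sum_const, card_shellIn_zero_typeClass hπ hπ' hS H (by omega), nsmul_eq_mul]
  push_cast
  simp only [map_mul, map_natCast]
  ring

/-! ### §4 The weighted generating polynomial of a shell: the component decomposition -/

/-- **The weighted shell generating polynomial is the same mixture with the weight riding along**:
`Σ_{U ∈ Shell_S(c+2s,c)} w(n_A(U))·X^{|U∩H|} = Σ_{Y ∈ halfSets(S,c)} Σ_{α ≤ s} w(α)C(a_Y,α)·X^{|Y∩H|+2α}·H_{b_Y,d_Y,s−α}`,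
`n_A(U) = #{v ∈ reps(vAA_π(S,H)) : v, πv ∈ U}`, `(a_Y,b_Y,d_Y)` the edge-type counts of `S ∖ (Y ∪ πY)`.
[cite: Rothvoss2017, §2 (PDF p. 6)] [cite: VatutinMikhailov1983, §2] -/
theorem weightedShellGen_eq_sum_halfSets_hyperGen {S : Finset (Fin n)} (hS : ∀ v ∈ S, π v ∈ S)
    (H : Finset (Fin n)) (w : ℕ → ℝ) (c s : ℕ) :
    ∑ U ∈ shellIn π S (c + 2 * s) c,
        C (w ((reps π (vAA π S H)).filter fun v => v ∈ U ∧ π v ∈ U).card) * (X : ℝ[X]) ^ (U ∩ H).card =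
      ∑ Y ∈ halfSets π S c, ∑ α ∈ range (s + 1),
        C (w α * (((reps π (vAA π (strip π S Y) H)).card.choose α : ℕ) : ℝ)) * X ^ ((Y ∩ H).card + 2 * α) *
          hyperGen (reps π (vBH π (strip π S Y) H ∪ vBN π (strip π S Y) H)).card
            (reps π (vDD π (strip π S Y) H)).card (s - α) := by
  rw [sum_shellIn_eq_sum_halfSets hπ _ (by omega : c ≤ c + 2 * s), Nat.add_sub_cancel_left]
  refine sum_congr rfl fun Y hY => ?_
  have hfib : ∀ W ∈ shellIn π (strip π S Y) (2 * s) 0,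
      C (w ((reps π (vAA π S H)).filter fun v => v ∈ W ∪ Y ∧ π v ∈ W ∪ Y).card) * (X : ℝ[X]) ^ ((W ∪ Y) ∩ H).card =
        X ^ (Y ∩ H).card * (C (w (reps π (W ∩ vAA π (strip π S Y) H)).card) * (X : ℝ[X]) ^ (W ∩ H).card) := by
    intro W hW
    rw [hhCount_union_eq hπ H hY hW, card_union_inter_eq hπ H hW, pow_add]
    ring
  rw [sum_congr rfl hfib, ← mul_sum, weightedShellGen_zero_eq_sum_hyperGen hπ hπ' (strip_stable hπ hS) H w s,
    mul_sum]
  refine sum_congr rfl fun α _ => ?_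
  rw [pow_add]
  ring

/-- **Total weighted mass.** `Σ_{U ∈ Shell_S(c+2s,c)} w(n_A(U)) = Σ_{Y,α} w(α)C(a_Y,α)·C(b_Y+d_Y,s−α)`.
[cite: Rothvoss2017, §2 (PDF p. 6)] -/
theorem sum_shellIn_weight_eq_sum_halfSets_types {S : Finset (Fin n)} (hS : ∀ v ∈ S, π v ∈ S)
    (H : Finset (Fin n)) (w : ℕ → ℝ) (c s : ℕ) :
    ∑ U ∈ shellIn π S (c + 2 * s) c, w ((reps π (vAA π S H)).filter fun v => v ∈ U ∧ π v ∈ U).card =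
      ∑ Y ∈ halfSets π S c, ∑ α ∈ range (s + 1),
        w α * (((reps π (vAA π (strip π S Y) H)).card.choose α : ℕ) : ℝ) *
          (((reps π (vBH π (strip π S Y) H ∪ vBN π (strip π S Y) H)).card +
              (reps π (vDD π (strip π S Y) H)).card).choose (s - α) : ℕ) := by
  have h := congrArg (fun P : ℝ[X] => P.eval 1) (weightedShellGen_eq_sum_halfSets_hyperGen hπ hπ' hS H w c s)
  simp only [eval_finsetSum, eval_mul, eval_C, eval_pow, eval_X, one_pow, mul_one, eval_one_hyperGen] at h
  exact h

end HalfSets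

/-! ### §5 The dictionary: weighted sections are coefficients of the weighted generating polynomial -/

/-- The coefficients of the weighted generating polynomial are the weighted sections:
`(Σ_U w(n_A(U)) X^{|U∩H|})_k = Σ_{U : |U∩H| = k} w(n_A(U))`. [cite: Rothvoss2017, §2 (PDF p. 6)] -/
theorem coeff_weightedShellGen (S H : Finset (Fin n)) (w : ℕ → ℝ) (t c k : ℕ) :
    (∑ U ∈ shellIn π S t c,
        C (w ((reps π (vAA π S H)).filter fun v => v ∈ U ∧ π v ∈ U).card) * (X : ℝ[X]) ^ (U ∩ H).card).coeff k =
      ∑ U ∈ ((shellIn π S t c).filter fun U => ((U ∩ H).card : ℤ) = k),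
        w ((reps π (vAA π S H)).filter fun v => v ∈ U ∧ π v ∈ U).card := by
  rw [finsetSum_coeff, sum_filter]
  refine sum_congr rfl fun U _ => ?_
  rw [coeff_C_mul, coeff_X_pow]
  by_cases h : ((U ∩ H).card : ℤ) = k
  · rw [if_pos h, if_pos (by exact_mod_cast h.symm), mul_one]
  · rw [if_neg h, if_neg (fun e => h (by exact_mod_cast e.symm)), mul_zero]

/-- Weighted sections vanish at negative arguments. [cite: Rothvoss2017, §2 (PDF p. 6)] -/
theorem weightedSection_eq_zero_of_neg (S H : Finset (Fin n)) (w : ℕ → ℝ) (t c : ℕ) {x : ℤ} (hx : x < 0) :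
    (∑ U ∈ ((shellIn π S t c).filter fun U => ((U ∩ H).card : ℤ) = x),
        w ((reps π (vAA π S H)).filter fun v => v ∈ U ∧ π v ∈ U).card) / ((shellIn π S t c).card : ℝ) = 0 := by
  have h : ((shellIn π S t c).filter fun U => ((U ∩ H).card : ℤ) = x) = ∅ := by
    rw [filter_eq_empty_iff]
    intro U _ e
    omega
  rw [h, sum_empty, zero_div]

/-- **Dictionary for weighted sections.** For `i ∈ ℕ`:
`(∇²)^m P^w_S(t,·)(c)(i) = |Shell_S(t,c)|⁻¹·((1−X)^{2m}·G^w_S(t,c))_i`, and the iterated difference vanishes at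
negative arguments (`ShellLawGeneratingPolynomial.nab2_iter_eq_coeff`). [cite: RollinRoss2010, §3 (Lemma 3.1)]
[cite: Rothvoss2017, §2 (PDF p. 6)] -/
theorem nab2_iter_weightedSection_natCast_eq (S H : Finset (Fin n)) (w : ℕ → ℝ) (t c m : ℕ) :
    (∀ i : ℕ, nab2^[m] (fun c' x => (∑ U ∈ ((shellIn π S t c').filter fun U => ((U ∩ H).card : ℤ) = x),
        w ((reps π (vAA π S H)).filter fun v => v ∈ U ∧ π v ∈ U).card) / ((shellIn π S t c').card : ℝ) : Profile)
        c i =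
      (1 / ((shellIn π S t c).card : ℝ)) *
        ((1 - X) ^ (2 * m) * ∑ U ∈ shellIn π S t c,
          C (w ((reps π (vAA π S H)).filter fun v => v ∈ U ∧ π v ∈ U).card) * (X : ℝ[X]) ^ (U ∩ H).card).coeff i) ∧
      ∀ x : ℤ, x < 0 → nab2^[m] (fun c' x => (∑ U ∈ ((shellIn π S t c').filter fun U => ((U ∩ H).card : ℤ) = x),
        w ((reps π (vAA π S H)).filter fun v => v ∈ U ∧ π v ∈ U).card) / ((shellIn π S t c').card : ℝ) : Profile)
        c x = 0 :=
  nab2_iter_eq_coeff _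
    (fun c' => ∑ U ∈ shellIn π S t c',
      C (w ((reps π (vAA π S H)).filter fun v => v ∈ U ∧ π v ∈ U).card) * (X : ℝ[X]) ^ (U ∩ H).card)
    (fun c' => 1 / ((shellIn π S t c').card : ℝ))
    (fun c' i => by rw [coeff_weightedShellGen, one_div, inv_mul_eq_div])
    (fun c' x hx => weightedSection_eq_zero_of_neg S H w t c' hx) m c

/-! ### §6 The good/far inequality at one point for a weighted section -/

section Weighted

variable (hπ : ∀ v, π (π v) = v) (hπ' : ∀ v, π v ≠ v)
include hπ hπ'

/-- **THE GOOD/FAR MIXTURE INEQUALITY FOR A WEIGHTED SECTION AT ONE POINT.** As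
`abs_nab2_iter_shellLaw_le_of_good_far`, for the weighted section `P^w_S(t,c;x) = (Σ_{U : |U∩H| = x} w(n_A(U)))/|Shell_S(t,c)|`
(`t = c + 2s`) of a weight with `0 ≤ w(α) ≤ W̄` for `α ≤ s`: if every good component `(Y,α)` obeys
`|((1−X)^{2m}·X^{σ}H)_i| ≤ E·(X^{σ}H)_{y₀}` and every other one `|((1−X)^{2m}·X^{σ}H)_i| ≤ A·H(1)`, then
`|(∇²)^m P^w(c)(i)| ≤ E·P^w(c; y₀) + A·W̄` (the far mass `Σ_{far} w(α)C(a_Y,α)C(b_Y+d_Y,s−α) ≤ W̄·|Shell|`).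
[cite: RollinRoss2010, §3 (Lemma 3.3)] [cite: Rothvoss2017, §2 (PDF p. 6)] [cite: VatutinMikhailov1983, §2] -/
theorem abs_nab2_iter_weightedSection_le_of_good_far {S : Finset (Fin n)} (hS : ∀ v ∈ S, π v ∈ S)
    (H : Finset (Fin n)) (w : ℕ → ℝ) {Wb : ℝ} (c s m i y₀ : ℕ) {E A : ℝ} (hE : 0 ≤ E) (hA : 0 ≤ A)
    (hw0 : ∀ α, α ≤ s → 0 ≤ w α) (hwb : ∀ α, α ≤ s → w α ≤ Wb)
    (good : Finset (Finset (Fin n) × ℕ))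
    (hgoodb : ∀ Y ∈ halfSets π S c, ∀ α ∈ range (s + 1), (Y, α) ∈ good →
      |((1 - X) ^ (2 * m) * (X ^ ((Y ∩ H).card + 2 * α) *
          hyperGen (reps π (vBH π (strip π S Y) H ∪ vBN π (strip π S Y) H)).card
            (reps π (vDD π (strip π S Y) H)).card (s - α))).coeff i| ≤
        E * (X ^ ((Y ∩ H).card + 2 * α) *
          hyperGen (reps π (vBH π (strip π S Y) H ∪ vBN π (strip π S Y) H)).card
            (reps π (vDD π (strip π S Y) H)).card (s - α)).coeff y₀)
    (hfar : ∀ Y ∈ halfSets π S c, ∀ α ∈ range (s + 1), (Y, α) ∉ good →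
      |((1 - X) ^ (2 * m) * (X ^ ((Y ∩ H).card + 2 * α) *
          hyperGen (reps π (vBH π (strip π S Y) H ∪ vBN π (strip π S Y) H)).card
            (reps π (vDD π (strip π S Y) H)).card (s - α))).coeff i| ≤
        A * ((((reps π (vBH π (strip π S Y) H ∪ vBN π (strip π S Y) H)).card +
          (reps π (vDD π (strip π S Y) H)).card).choose (s - α) : ℕ) : ℝ)) :
    |nab2^[m] (fun c' x => (∑ U ∈ ((shellIn π S (c + 2 * s) c').filter fun U => ((U ∩ H).card : ℤ) = x),
        w ((reps π (vAA π S H)).filter fun v => v ∈ U ∧ π v ∈ U).card) /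
          ((shellIn π S (c + 2 * s) c').card : ℝ) : Profile) c i| ≤
      E * ((∑ U ∈ ((shellIn π S (c + 2 * s) c).filter fun U => ((U ∩ H).card : ℤ) = y₀),
        w ((reps π (vAA π S H)).filter fun v => v ∈ U ∧ π v ∈ U).card) /
          ((shellIn π S (c + 2 * s) c).card : ℝ)) + A * Wb := by
  classical
  -- the mixture, indexed by the product `halfSets × range (s+1)`, weights `w(α)·C(a_Y,α)`
  set ι := halfSets π S c ×ˢ range (s + 1) with hι
  set wt : Finset (Fin n) × ℕ → ℝ := fun κ =>
    w κ.2 * (((reps π (vAA π (strip π S κ.1) H)).card.choose κ.2 : ℕ) : ℝ) with hwt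
  set σ : Finset (Fin n) × ℕ → ℕ := fun κ => (κ.1 ∩ H).card + 2 * κ.2 with hσ
  set Hκ : Finset (Fin n) × ℕ → ℝ[X] := fun κ =>
    hyperGen (reps π (vBH π (strip π S κ.1) H ∪ vBN π (strip π S κ.1) H)).card
      (reps π (vDD π (strip π S κ.1) H)).card (s - κ.2) with hHκ
  have hG : ∑ U ∈ shellIn π S (c + 2 * s) c,
      C (w ((reps π (vAA π S H)).filter fun v => v ∈ U ∧ π v ∈ U).card) * (X : ℝ[X]) ^ (U ∩ H).card =
      ∑ κ ∈ ι, C (wt κ) * X ^ (σ κ) * Hκ κ := by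
    rw [weightedShellGen_eq_sum_halfSets_hyperGen hπ hπ' hS H w c s, hι, sum_product]
  have hw0' : ∀ κ ∈ ι, 0 ≤ wt κ := fun κ hκ =>
    mul_nonneg (hw0 κ.2 (Nat.lt_succ_iff.1 (mem_range.1 (mem_product.1 hκ).2))) (Nat.cast_nonneg _)
  have hH0 : ∀ κ ∈ ι, ∀ k, 0 ≤ (Hκ κ).coeff k := fun κ _ k => coeff_hyperGen_nonneg _ _ _ k
  set goodι := ι.filter (fun κ => κ ∈ good) with hgoodι
  have hsub : goodι ⊆ ι := filter_subset _ _
  have hmix := abs_coeff_mixture_le_of_good_far ι goodι hsub wt σ Hκ ((1 - X) ^ (2 * m)) i y₀ hE hw0' hH0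
    (fun κ hκ => by
      obtain ⟨hκι, hκg⟩ := mem_filter.1 hκ
      obtain ⟨hY, hα⟩ := mem_product.1 hκι
      exact hgoodb κ.1 hY κ.2 hα hκg)
    (fun κ hκ => by
      obtain ⟨hκι, hκg⟩ := mem_sdiff.1 hκ
      obtain ⟨hY, hα⟩ := mem_product.1 hκι
      have hng : κ ∉ good := fun h => hκg (mem_filter.2 ⟨hκι, h⟩)
      have h := hfar κ.1 hY κ.2 hα hng
      rwa [← eval_one_hyperGen] at h)
  -- the far mass is at most `W̄·|Shell|`
  have hWb0 : 0 ≤ Wb := (hw0 0 (Nat.zero_le _)).trans (hwb 0 (Nat.zero_le _))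
  have hfarmass : ∑ κ ∈ ι \ goodι, wt κ * (Hκ κ).eval 1 ≤ Wb * ((shellIn π S (c + 2 * s) c).card : ℝ) := by
    calc ∑ κ ∈ ι \ goodι, wt κ * (Hκ κ).eval 1 ≤ ∑ κ ∈ ι, wt κ * (Hκ κ).eval 1 :=
          sum_le_sum_of_subset_of_nonneg sdiff_subset fun κ hκ _ =>
            mul_nonneg (hw0' κ hκ) (eval_one_nonneg_of_nonneg (hH0 κ hκ))
      _ ≤ ∑ κ ∈ ι, Wb * ((((reps π (vAA π (strip π S κ.1) H)).card.choose κ.2 : ℕ) : ℝ) * (Hκ κ).eval 1) := by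
          refine sum_le_sum fun κ hκ => ?_
          rw [hwt]
          dsimp only
          rw [mul_assoc]
          exact mul_le_mul_of_nonneg_right (hwb κ.2 (Nat.lt_succ_iff.1 (mem_range.1 (mem_product.1 hκ).2)))
            (mul_nonneg (Nat.cast_nonneg _) (eval_one_nonneg_of_nonneg (hH0 κ hκ)))
      _ = Wb * ((shellIn π S (c + 2 * s) c).card : ℝ) := by
          rw [← mul_sum, card_shellIn_eq_sum_halfSets_types hπ hπ' hS H c s, hι, sum_product]
          congr 1
          refine sum_congr rfl fun Y _ => sum_congr rfl fun α _ => ?_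
          rw [hHκ]
          dsimp only
          rw [eval_one_hyperGen]
  -- translate back to the weighted section
  obtain ⟨hd1, -⟩ := nab2_iter_weightedSection_natCast_eq S H w (c + 2 * s) c m
  rw [hd1 i, hG]
  have hy₀ : (∑ κ ∈ ι, C (wt κ) * X ^ (σ κ) * Hκ κ).coeff y₀ =
      ∑ U ∈ ((shellIn π S (c + 2 * s) c).filter fun U => ((U ∩ H).card : ℤ) = y₀),
        w ((reps π (vAA π S H)).filter fun v => v ∈ U ∧ π v ∈ U).card := by
    rw [← hG, coeff_weightedShellGen]
  rw [hy₀] at hmix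
  by_cases h0 : (shellIn π S (c + 2 * s) c).card = 0
  · -- empty shell: everything vanishes
    have hempty : shellIn π S (c + 2 * s) c = ∅ := card_eq_zero.1 h0
    rw [h0, Nat.cast_zero, div_zero, zero_mul, abs_zero, hempty, filter_empty, sum_empty, zero_div, mul_zero,
      zero_add]
    exact mul_nonneg hA hWb0
  · have hcard : (0 : ℝ) < ((shellIn π S (c + 2 * s) c).card : ℝ) := by
      exact_mod_cast Nat.pos_of_ne_zero h0
    rw [abs_mul, abs_of_nonneg (by positivity : (0 : ℝ) ≤ 1 / ((shellIn π S (c + 2 * s) c).card : ℝ))]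
    calc 1 / ((shellIn π S (c + 2 * s) c).card : ℝ) *
          |((1 - X) ^ (2 * m) * ∑ κ ∈ ι, C (wt κ) * X ^ (σ κ) * Hκ κ).coeff i|
        ≤ 1 / ((shellIn π S (c + 2 * s) c).card : ℝ) *
          (E * ∑ U ∈ ((shellIn π S (c + 2 * s) c).filter fun U => ((U ∩ H).card : ℤ) = y₀),
              w ((reps π (vAA π S H)).filter fun v => v ∈ U ∧ π v ∈ U).card +
            A * (Wb * ((shellIn π S (c + 2 * s) c).card : ℝ))) := by
          refine mul_le_mul_of_nonneg_left (hmix.trans ?_) (by positivity)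
          exact add_le_add le_rfl (mul_le_mul_of_nonneg_left hfarmass hA)
      _ = _ := by
          field_simp

/-! ### §7 The pointwise relative bound for a weighted level-`1` section on one ground set -/

/-- **POINTWISE RELATIVE `x`-SMOOTHNESS OF A WEIGHTED LEVEL-`1` SECTION** (the weighted form of
`abs_nab2_iter_shellLaw_one_le`, same hypotheses and constants). `π` a fixed-point-free involution, `S` `π`-stable of
`H`-type `(a,b,d)` with `a + b + d = N`, type margins `b, d ≥ βN + 1` (`0 < β ≤ 1`), `βN ≤ s ≤ (4+β)N/8` (`s ≤ N`);
a weight `0 ≤ w(α) ≤ W̄` (`α ≤ s`); a reference point `y₀` within `Λ` of `s(2a+b)/N`, an order `k`, an offset `u ≤ 2k`,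
a window half-width `L` with `2k ≤ L`, `L − 2k ≤ 2N`, `L + k + Λ ≤ βs`, `L + k + Λ + 3 ≤ βN/8`, `2(L+k+1) ≤ β₁²βN`,
`4 ≤ βN`, `k(1+η̄) ≤ β₁⁴βN`. Then for the weighted section `P^w(c;x) = (Σ_{U ∈ Shell_S(2s+1,c), |U∩H|=x} w(n_A(U)))/|Shell|`:
`|(∇²)^k P^w(1)(y₀+u)| ≤ E_k·P^w(1;y₀) + W̄·4^k·e^{−(L−2k)²/(4N)}`, `E_k = ((1+η̄)(η̄+Q̄))^{2k}(1 + (4(√N+1)/3)Q̄)`.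
[cite: RollinRoss2010, §3 (Lemma 3.3), §4.1 Thm 4.2] [cite: Rothvoss2017, §2 (PDF p. 6)] [cite: Durrett2019, §2.7] -/
theorem abs_nab2_iter_weightedSection_one_le {S : Finset (Fin n)} (hS : ∀ v ∈ S, π v ∈ S) (H : Finset (Fin n))
    {a b d N : ℕ} (hb : (reps π (vBH π S H ∪ vBN π S H)).card = b)
    (hd : (reps π (vDD π S H)).card = d) (hN : a + b + d = N)
    {β : ℝ} (hβ : 0 < β) (hβ1 : β ≤ 1)
    (hbβ : β * N + 1 ≤ b) (hdβ : β * N + 1 ≤ d)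
    {s : ℕ} (hs : β * N ≤ s) (hs' : 8 * (s : ℝ) ≤ (4 + β) * N) (hsN : s ≤ N)
    (w : ℕ → ℝ) {Wb : ℝ} (hw0 : ∀ α, α ≤ s → 0 ≤ w α) (hwb : ∀ α, α ≤ s → w α ≤ Wb)
    {k u y₀ : ℕ} (hu : u ≤ 2 * k) {L Λ : ℝ} (h2kL : 2 * (k : ℝ) ≤ L) (hLN : L - 2 * k ≤ 2 * N)
    (hL1 : L + k + Λ ≤ β * s) (hL2 : L + k + Λ + 3 ≤ β * N / 8)
    (hwin : 2 * (L + k + 1) ≤ (β ^ 2 / 8) ^ 2 * (β * N)) (hN4 : 4 ≤ β * N)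
    (hkV : (k : ℝ) * (1 + 8 * (L + k + 1) / ((β ^ 2 / 8) ^ 4 * (β * N))) ≤ (β ^ 2 / 8) ^ 4 * (β * N))
    (hy : |(y₀ : ℝ) - s * (2 * a + b) / N| ≤ Λ) :
    |nab2^[k] (fun c' x => (∑ U ∈ ((shellIn π S (1 + 2 * s) c').filter fun U => ((U ∩ H).card : ℤ) = x),
        w ((reps π (vAA π S H)).filter fun v => v ∈ U ∧ π v ∈ U).card) /
          ((shellIn π S (1 + 2 * s) c').card : ℝ) : Profile) 1 ((y₀ + u : ℕ) : ℤ)| ≤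
      (((1 + 8 * (L + k + 1) / ((β ^ 2 / 8) ^ 4 * (β * N))) *
            (8 * (L + k + 1) / ((β ^ 2 / 8) ^ 4 * (β * N)) +
              2 * Real.sqrt 192 * Real.sqrt (2 * (2 * (k : ℝ) + 1) *
                (1 + 8 * (L + k + 1) / ((β ^ 2 / 8) ^ 4 * (β * N))) / ((β ^ 2 / 8) ^ 4 * (β * N))))) ^ (2 * k) *
          (1 + 4 * (Real.sqrt N + 1) / 3 *
            (2 * Real.sqrt 192 * Real.sqrt (2 * (2 * (k : ℝ) + 1) *
              (1 + 8 * (L + k + 1) / ((β ^ 2 / 8) ^ 4 * (β * N))) / ((β ^ 2 / 8) ^ 4 * (β * N)))))) *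
        ((∑ U ∈ ((shellIn π S (1 + 2 * s) 1).filter fun U => ((U ∩ H).card : ℤ) = y₀),
          w ((reps π (vAA π S H)).filter fun v => v ∈ U ∧ π v ∈ U).card) /
            ((shellIn π S (1 + 2 * s) 1).card : ℝ)) +
      Wb * ((4 : ℝ) ^ k * Real.exp (-((L - 2 * k) ^ 2 / (4 * N)))) := by
  classical
  have hL0 : 0 ≤ L := le_trans (by positivity) h2kL
  have hN0 : (0 : ℝ) < N := by
    have : (0 : ℝ) < β * N := by linarith
    exact pos_of_mul_pos_right this hβ.le
  -- the good set: components whose centre is within `L` of `y₀`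
  set good : Finset (Finset (Fin n) × ℕ) := (halfSets π S 1 ×ˢ range (s + 1)).filter (fun κ =>
    |(y₀ : ℝ) - (κ.1 ∩ H).card - 2 * κ.2 -
        ((s - κ.2 : ℕ) : ℝ) * (reps π (vBH π (strip π S κ.1) H ∪ vBN π (strip π S κ.1) H)).card /
          (((reps π (vBH π (strip π S κ.1) H ∪ vBN π (strip π S κ.1) H)).card : ℝ) +
            (reps π (vDD π (strip π S κ.1) H)).card)| ≤ L) with hgood
  rw [mul_comm Wb]
  refine abs_nab2_iter_weightedSection_le_of_good_far hπ hπ' hS H w 1 s k (y₀ + u) y₀ (by positivity)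
    (by positivity) hw0 hwb good ?_ ?_
  · intro Y hY α hα hmem
    have hαs : α ≤ s := Nat.lt_succ_iff.1 (mem_range.1 hα)
    have hg := (mem_filter.1 hmem).2
    exact good_component_bound hπ hπ' hS H hb hd hN hβ hβ1 hbβ hdβ hs hs' hu hL0 hL1 hL2 hwin hN4 hkV hy hY hαs hg
  · intro Y hY α hα hnot
    have hfar : L < |(y₀ : ℝ) - (Y ∩ H).card - 2 * α -
        ((s - α : ℕ) : ℝ) * (reps π (vBH π (strip π S Y) H ∪ vBN π (strip π S Y) H)).card /
          (((reps π (vBH π (strip π S Y) H ∪ vBN π (strip π S Y) H)).card : ℝ) +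
            (reps π (vDD π (strip π S Y) H)).card)| := by
      by_contra hle
      exact hnot (mem_filter.2 ⟨mem_product.2 ⟨hY, hα⟩, not_lt.1 hle⟩)
    exact far_component_bound hu (by exact_mod_cast hsN) hN0 h2kL hLN hfar

end Weighted

end ShellStep

end Literature.Combinatorics.Optimization

end
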